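import Mathlib
import Literature.NumberTheory.Transcendental.PeriodsWave0
import Literature.NumberTheory.Transcendental.BoxIntegralZetaValues
import Literature.NumberTheory.Transcendental.KZCubicalCalculus
import HarnessLib

/-!
# SoloInformed — the alternating zeta value `η(n)` as a box integral

`η(n) = Σ_{k ≥ 0} (-1)^k/(k+1)^n` (the Dirichlet eta function at an integer `n ≥ 2`) satisfies

* `η(n) = (1 − 2/2ⁿ) · ζ(n)` with `ζ(n) = zetaValue n` (`soloInformed_eta_eq`), hence `η(n) > 0`
  and `η(n) ∈ ℚ ↔ ζ(n) ∈ ℚ`;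
* `η(n) = ∫_{(0,1)ⁿ} dx/(1 + x₀⋯x_{n−1})` (`soloInformed_setIntegral_box_inv_one_add_prod`), and the
  same over the closed unit cube `KZ.cube n` (`soloInformed_setIntegral_cube_inv_one_add_prod`),
  the difference being a null set.

The integrand `1/(1 + x₀⋯x_{n−1})` is bounded by `1` on the closed cube, so — unlike Beukers' kernel
`1/(1 − x₀⋯x_{n−1})` — the solid under its graph is a COMPACT `ℚ`-semialgebraic solid of `ℝⁿ⁺¹` of
volume `(1 − 2^{1−n}) ζ(n)`; this is the solid the volume rung `n + 1` is tested against in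
`SoloInformedWallFaces` (paper §3bis). Pure analysis; no calculus moves here.

Residency `solo-KontsevichZagierPeriods-informed` (PLAN.md, session s18).
References: [folklore] (Dirichlet eta; term-wise integration of the geometric series, as in the
tree's `BoxIntegral.setIntegral_box_one_div_one_sub_prod_eq_zetaValue`).
-/

noncomputable section

open MeasureTheory Set Filter

namespace Summit.KontsevichZagierPeriods.KontsevichZagierPeriods.Theorems

open Literature.NumberTheory.Transcendental Literature.NumberTheory.Transcendental.BoxIntegral

variable {n : ℕ}

/-! ### `η(n)` and `ζ(n)` -/

/-- The alternating zeta value `η(n) = Σ_{k ≥ 0} (-1)^k/(k+1)^n`. -/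
def soloInformedEta (n : ℕ) : ℝ := ∑' k : ℕ, (-1 : ℝ) ^ k / ((k : ℝ) + 1) ^ n

/-- `m ↦ 1/mⁿ` is summable for `n ≥ 2` (junk term `1/0ⁿ = 0` included). [folklore] -/
theorem soloInformed_summable_one_div_pow (hn : 2 ≤ n) : Summable fun m : ℕ => 1 / (m : ℝ) ^ n :=
  Real.summable_one_div_nat_pow.mpr (by omega)

/-- `m ↦ (-1)^(m+1)/mⁿ` is summable for `n ≥ 2`. [folklore] -/
theorem soloInformed_summable_alt (hn : 2 ≤ n) :
    Summable fun m : ℕ => (-1 : ℝ) ^ (m + 1) / (m : ℝ) ^ n := by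
  refine Summable.of_norm_bounded (soloInformed_summable_one_div_pow hn) fun m => ?_
  rw [norm_div, norm_pow, norm_neg, norm_one, one_pow, norm_pow, Real.norm_eq_abs,
    abs_of_nonneg (Nat.cast_nonneg m)]

/-- `ζ(n) ≥ 1` for `n ≥ 2` (the term `m = 1`). [folklore] -/
theorem soloInformed_one_le_zetaValue (hn : 2 ≤ n) : 1 ≤ zetaValue n := by
  have h := (soloInformed_summable_one_div_pow hn).le_tsum 1 fun j _ => by positivity
  simpa [zetaValue] using h

/-- `ζ(n) > 0` for `n ≥ 2`. [folklore] -/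
theorem soloInformed_zetaValue_pos (hn : 2 ≤ n) : 0 < zetaValue n :=
  lt_of_lt_of_le one_pos (soloInformed_one_le_zetaValue hn)

/-- The even-indexed part of `ζ(n)`: `Σ_k 1/(2k)ⁿ = ζ(n)/2ⁿ`. [folklore] -/
theorem soloInformed_tsum_even (n : ℕ) :
    ∑' k : ℕ, 1 / (((2 * k : ℕ) : ℝ)) ^ n = zetaValue n / 2 ^ n := by
  have e : ∀ k : ℕ, 1 / (((2 * k : ℕ) : ℝ)) ^ n = (1 / 2 ^ n) * (1 / (k : ℝ) ^ n) := fun k => by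
    push_cast
    rw [mul_pow, one_div_mul_one_div]
  simp_rw [e, tsum_mul_left, zetaValue]
  ring

/-- `k ↦ 2k` is injective on `ℕ`. -/
theorem soloInformed_injective_two_mul : Function.Injective (fun k : ℕ => 2 * k) :=
  fun a b h => by dsimp at h; omega

/-- `k ↦ 2k+1` is injective on `ℕ`. -/
theorem soloInformed_injective_two_mul_add_one : Function.Injective (fun k : ℕ => 2 * k + 1) :=
  fun a b h => by dsimp at h; omega

/-- The odd-indexed part of `ζ(n)`: `Σ_k 1/(2k+1)ⁿ = ζ(n) − ζ(n)/2ⁿ` (`n ≥ 2`). [folklore] -/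
theorem soloInformed_tsum_odd (hn : 2 ≤ n) :
    ∑' k : ℕ, 1 / (((2 * k + 1 : ℕ) : ℝ)) ^ n = zetaValue n - zetaValue n / 2 ^ n := by
  have hf := soloInformed_summable_one_div_pow hn
  have he : Summable fun k : ℕ => 1 / (((2 * k : ℕ) : ℝ)) ^ n :=
    hf.comp_injective soloInformed_injective_two_mul
  have ho : Summable fun k : ℕ => 1 / (((2 * k + 1 : ℕ) : ℝ)) ^ n :=
    hf.comp_injective soloInformed_injective_two_mul_add_one
  have h := tsum_even_add_odd (f := fun m : ℕ => 1 / (m : ℝ) ^ n) he ho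
  have hz : ∑' m : ℕ, 1 / (m : ℝ) ^ n = zetaValue n := rfl
  rw [soloInformed_tsum_even, hz] at h
  linarith

/-- `η(n)` is the shifted alternating series `Σ_{m ≥ 0} (-1)^(m+1)/mⁿ` (junk term `m = 0`
vanishes, `n ≥ 1`). [folklore] -/
theorem soloInformed_eta_eq_tsum_alt (hn : 2 ≤ n) :
    soloInformedEta n = ∑' m : ℕ, (-1 : ℝ) ^ (m + 1) / (m : ℝ) ^ n := by
  have hn0 : n ≠ 0 := by omega
  rw [(soloInformed_summable_alt hn).tsum_eq_zero_add]
  have e0 : (-1 : ℝ) ^ (0 + 1) / ((0 : ℕ) : ℝ) ^ n = 0 := by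
    rw [Nat.cast_zero, zero_pow hn0, div_zero]
  rw [e0, zero_add, soloInformedEta]
  refine tsum_congr fun k => ?_
  have e1 : (-1 : ℝ) ^ (k + 1 + 1) = (-1) ^ k := by
    rw [pow_succ, pow_succ, mul_assoc, neg_one_mul, neg_neg, mul_one]
  rw [e1, Nat.cast_succ]

/-- The alternating series split into even and odd parts:
`Σ_m (-1)^(m+1)/mⁿ = −ζ(n)/2ⁿ + (ζ(n) − ζ(n)/2ⁿ)` (`n ≥ 2`). [folklore] -/
theorem soloInformed_tsum_alt_eq (hn : 2 ≤ n) :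
    ∑' m : ℕ, (-1 : ℝ) ^ (m + 1) / (m : ℝ) ^ n =
      -(zetaValue n / 2 ^ n) + (zetaValue n - zetaValue n / 2 ^ n) := by
  have hF := soloInformed_summable_alt hn
  have he : Summable fun k : ℕ => (-1 : ℝ) ^ (2 * k + 1) / (((2 * k : ℕ) : ℝ)) ^ n :=
    hF.comp_injective soloInformed_injective_two_mul
  have ho : Summable fun k : ℕ => (-1 : ℝ) ^ (2 * k + 1 + 1) / (((2 * k + 1 : ℕ) : ℝ)) ^ n :=
    hF.comp_injective soloInformed_injective_two_mul_add_one
  have h := tsum_even_add_odd (f := fun m : ℕ => (-1 : ℝ) ^ (m + 1) / (m : ℝ) ^ n) he ho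
  have hEe : ∑' k : ℕ, (-1 : ℝ) ^ (2 * k + 1) / (((2 * k : ℕ) : ℝ)) ^ n =
      -(zetaValue n / 2 ^ n) := by
    rw [← soloInformed_tsum_even n, ← tsum_neg]
    refine tsum_congr fun k => ?_
    rw [pow_succ, pow_mul, neg_one_sq, one_pow, one_mul, neg_div, one_div]
  have hOo : ∑' k : ℕ, (-1 : ℝ) ^ (2 * k + 1 + 1) / (((2 * k + 1 : ℕ) : ℝ)) ^ n =
      ∑' k : ℕ, 1 / (((2 * k + 1 : ℕ) : ℝ)) ^ n := by
    refine tsum_congr fun k => ?_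
    have e : 2 * k + 1 + 1 = 2 * (k + 1) := by ring
    rw [e, pow_mul, neg_one_sq, one_pow]
  rw [← h, hEe, hOo, soloInformed_tsum_odd hn]

/-- **`η(n) = (1 − 2/2ⁿ) ζ(n)`** for `n ≥ 2`. [folklore] -/
theorem soloInformed_eta_eq (hn : 2 ≤ n) : soloInformedEta n = (1 - 2 / 2 ^ n) * zetaValue n := by
  rw [soloInformed_eta_eq_tsum_alt hn, soloInformed_tsum_alt_eq hn]
  ring

/-- `0 < 1 − 2/2ⁿ` for `n ≥ 2`. -/
theorem soloInformed_eta_factor_pos (hn : 2 ≤ n) : (0 : ℝ) < 1 - 2 / 2 ^ n := by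
  have h4 : (4 : ℝ) ≤ 2 ^ n := by
    have h := pow_le_pow_right₀ (by norm_num : (1 : ℝ) ≤ 2) hn
    norm_num at h
    exact h
  rw [sub_pos, div_lt_one (by positivity)]
  linarith

/-- `η(n) > 0` for `n ≥ 2`. [folklore] -/
theorem soloInformed_eta_pos (hn : 2 ≤ n) : 0 < soloInformedEta n := by
  rw [soloInformed_eta_eq hn]
  exact mul_pos (soloInformed_eta_factor_pos hn) (soloInformed_zetaValue_pos hn)

/-- `(1 − 2/2ⁿ) ζ(n)` is irrational iff `ζ(n)` is (`n ≥ 2`; the factor is a non-zero rational).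
[folklore] -/
theorem soloInformed_irrational_factor_mul_zetaValue_iff (hn : 2 ≤ n) :
    Irrational ((1 - 2 / 2 ^ n) * zetaValue n) ↔ Irrational (zetaValue n) := by
  have hq : (1 - 2 / 2 ^ n : ℝ) = ((1 - 2 / 2 ^ n : ℚ) : ℝ) := by push_cast; rfl
  have hq0 : (1 - 2 / 2 ^ n : ℚ) ≠ 0 := by
    have h := soloInformed_eta_factor_pos hn
    rw [hq] at h
    exact_mod_cast h.ne'
  rw [hq]
  exact irrational_ratCast_mul_iff.trans ⟨fun h => h.2, fun h => ⟨hq0, h⟩⟩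

/-- `η(n)` is irrational iff `ζ(n)` is (`n ≥ 2`). [folklore] -/
theorem soloInformed_irrational_eta_iff (hn : 2 ≤ n) :
    Irrational (soloInformedEta n) ↔ Irrational (zetaValue n) := by
  rw [soloInformed_eta_eq hn]
  exact soloInformed_irrational_factor_mul_zetaValue_iff hn

/-! ### `η(n)` as a box integral -/

/-- On the open unit box the alternating geometric series sums the kernel:
`Σ_k (-1)^k (x₀⋯x_{n−1})ᵏ = 1/(1 + x₀⋯x_{n−1})` (`n ≥ 1`). [folklore] -/
theorem soloInformed_hasSum_neg_prod_pow (hn : n ≠ 0) {x : Fin n → ℝ}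
    (hx : ∀ i, x i ∈ Ioo (0 : ℝ) 1) :
    HasSum (fun k : ℕ => (-1 : ℝ) ^ k * (∏ i, x i) ^ k) (1 + ∏ i, x i)⁻¹ := by
  have hu := prod_mem_Ioo hn hx
  have h := hasSum_geometric_of_abs_lt_one (r := -∏ i, x i)
    (by rw [abs_neg, abs_of_pos hu.1]; exact hu.2)
  rw [sub_neg_eq_add] at h
  convert h using 1
  funext k
  exact (neg_pow (∏ i, x i) k).symm

/-- **`η(n)` as a period over the open unit box**: for `n ≥ 2`,
`∫_{(0,1)ⁿ} dx/(1 + x₀⋯x_{n−1}) = Σ_{k≥0} (-1)^k/(k+1)ⁿ = η(n)` (term-wise integration, absolutely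
convergent since `Σ 1/(k+1)ⁿ < ∞`). [folklore] -/
theorem soloInformed_setIntegral_box_inv_one_add_prod (hn : 2 ≤ n) :
    ∫ x in {x : Fin n → ℝ | ∀ i, x i ∈ Ioo (0 : ℝ) 1}, (1 + ∏ i, x i)⁻¹ = soloInformedEta n := by
  have hn0 : n ≠ 0 := by omega
  set B := {x : Fin n → ℝ | ∀ i, x i ∈ Ioo (0 : ℝ) 1} with hB
  have hnorm : ∀ k : ℕ, ∫ x in B, ‖(-1 : ℝ) ^ k * (∏ i, x i) ^ k‖ = (1 / ((k : ℝ) + 1)) ^ n := by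
    intro k
    rw [← setIntegral_box_prod_pow n k]
    refine setIntegral_congr_fun (Beukers.measurableSet_cube n) fun x hx => ?_
    rw [norm_mul, norm_pow, norm_neg, norm_one, one_pow, one_mul,
      Real.norm_of_nonneg (pow_nonneg (Finset.prod_nonneg fun i _ => (hx i).1.le) k)]
  have hsum : Summable fun k : ℕ => ∫ x in B, ‖(-1 : ℝ) ^ k * (∏ i, x i) ^ k‖ := by
    simp_rw [hnorm]
    exact summable_one_div_succ_pow' hn
  have h := hasSum_integral_of_summable_integral_norm (μ := volume.restrict B)
    (F := fun (k : ℕ) (x : Fin n → ℝ) => (-1 : ℝ) ^ k * (∏ i, x i) ^ k)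
    (fun k => (integrableOn_box_prod_pow n k).const_mul _) hsum
  have hint : ∀ k : ℕ, ∫ x in B, (-1 : ℝ) ^ k * (∏ i, x i) ^ k = (-1 : ℝ) ^ k / ((k : ℝ) + 1) ^ n := by
    intro k
    rw [integral_const_mul, setIntegral_box_prod_pow n k, one_div_pow, mul_one_div]
  simp_rw [hint] at h
  have hlim : ∫ x in B, (∑' k : ℕ, (-1 : ℝ) ^ k * (∏ i, x i) ^ k) = ∫ x in B, (1 + ∏ i, x i)⁻¹ :=
    setIntegral_congr_fun (Beukers.measurableSet_cube n) fun x hx =>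
      (soloInformed_hasSum_neg_prod_pow hn0 hx).tsum_eq
  rw [← hlim, ← h.tsum_eq, soloInformedEta]

/-! ### Over the closed unit cube `KZ.cube n` -/

/-- The closed unit cube `KZ.cube n = [0,1]ⁿ` and the open unit box differ by a null set.
[folklore] -/
theorem soloInformed_cube_ae_eq_box (n : ℕ) :
    (KZ.cube n : Set (Fin n → ℝ)) =ᵐ[volume] {x : Fin n → ℝ | ∀ i, x i ∈ Ioo (0 : ℝ) 1} := by
  rw [KZ.cube_eq_Icc, Beukers.setOf_forall_mem_Ioo_eq_pi, volume_pi]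
  exact (Measure.univ_pi_Ioo_ae_eq_Icc (f := fun _ : Fin n => (0 : ℝ)) (g := fun _ => (1 : ℝ))).symm

/-- Integrals over the closed cube and over the open box agree. [folklore] -/
theorem soloInformed_setIntegral_cube_eq_box (n : ℕ) (g : (Fin n → ℝ) → ℝ) :
    ∫ x in KZ.cube n, g x = ∫ x in {x : Fin n → ℝ | ∀ i, x i ∈ Ioo (0 : ℝ) 1}, g x :=
  setIntegral_congr_set (soloInformed_cube_ae_eq_box n)

/-- **`∫_{[0,1]ⁿ} dx/(1 + x₀⋯x_{n−1}) = η(n) = (1 − 2/2ⁿ) ζ(n)`** (`n ≥ 2`). [folklore] -/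
theorem soloInformed_setIntegral_cube_inv_one_add_prod (hn : 2 ≤ n) :
    ∫ x in KZ.cube n, (1 + ∏ i, x i)⁻¹ = (1 - 2 / 2 ^ n) * zetaValue n := by
  rw [soloInformed_setIntegral_cube_eq_box, soloInformed_setIntegral_box_inv_one_add_prod hn,
    soloInformed_eta_eq hn]

end Summit.KontsevichZagierPeriods.KontsevichZagierPeriods.Theorems
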